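import Summits.CriticalPhenomena.SAWScalingLimit.Theorems.SAWRenewalTightnessRoomEntropyDefs
import Literature.Probability.RandomPlanarGeometry.LoewnerRoomObservableFarField
import Literature.Probability.Process.LocalMartingaleFromObservables
import Literature.Probability.RandomPlanarGeometry.SLELawOfDrivingProcessLocal
import Literature.Probability.RandomPlanarGeometry.DrivingFunctionMeasurable
import Literature.Probability.RandomPlanarGeometry.LoewnerDescription
import HarnessLib

/-!
# `stub_roomEntropyCharacterisesSLE`: the room–entropy observable characterises SLE(8/3)

Stub `stub_roomEntropyCharacterisesSLE` of the registered skeleton of the line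
`room-entropy-wright-fisher` for the crux `SubseqIdentification` (stmt-CriticalPhenomena-0783,
route `SAWRenewalTightness`, shared with `SAWParafermion` / `SAWLeftRightFKG` /
`SAWAsymptoticMorera`; vocabulary `Theorems/SAWRenewalTightnessRoomEntropyDefs.lean`): the
CONTINUUM ENDGAME of the line. If `ν` is a probability measure on curve classes, `ν`-a.e. class
is Loewner-describable through the chordal uniformizing map `φ` and starts at `a`, the driving
process `W = drivingFunction φ` is adapted to a filtration `𝓕`, and for every `w ∈ ℍ` and every
cap `m` the stopped room–entropy observable `N^{w,m}_t = log ψ_{t∧τ} + 3 H(S_{t∧τ})`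
(`roomObsStopped`; `ψ` = `Loewner.derivRatio`, `S` = `Loewner.schrammObs`, `τ = roomStop`) is an
`𝓕`-martingale, then `ν` is the chordal SLE(8/3) law of `(D; a, b)`.

Proof (short glue over two Literature files landed for this stub):

* `Literature/Probability/RandomPlanarGeometry/LoewnerRoomObservableFarField.lean` — the
  deterministic far-field expansion of `N` for an arbitrary continuous driving function:
  at `w = y(3+4i)/5`, `N^{w,m}_r = 3H(4/5) + (24 log 4/25) W_r/y + O(((K+√T)/y)²)` (first
  order, nonzero coefficient), and at `w = iy`,
  `N^{iy,m}_r = 3 log 2 - (3/2)(W_r² - (8/3) r)/y² + O(((K+√T)/y)³)` (second order: the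
  coefficient `-3/2 = ½Λ''(π/2)` of `W²` against the `4 r` of `log ψ` pins `κ = 8/3`), uniformly
  on the paths with `|W| ≤ K` on `[0, r]`, `r ≤ T ≤ m + 1`, where the room stop has not occurred
  (`exists_level_roomObs_order_one/two`); and continuity of `t ↦ N^{w,m}_t`
  (`continuous_roomObs_min`), needed for optional stopping.
* `Literature/Probability/Process/LocalMartingaleFromObservables.lean` — the probabilistic
  matching WITHOUT moment hypotheses: localise at the exit times `σ_K` of `W` from `(-K, K)`
  (stopping times, `|W^{σ_K}| ≤ K`), stop the observable martingales there (optional stopping for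
  continuous martingales of a raw filtration), transfer the martingale identity through the
  affine approximations (`L¹`-contractivity of conditional expectation) and let `y → ∞`:
  `W^{σ_K}` and `(W^{σ_K})² - (8/3)(· ∧ σ_K)` are martingales for every `K`, whence
  `W/√(8/3)` is a continuous local martingale with quadratic variation `t`
  (`isLocalMartingale_hasQuadraticVariation_of_approx`).
* The tree's PROVED martingale identification for `κ < 4`,
  `isSLELaw_of_isLocalMartingale_driving_of_lt_four` (Lévy's characterisation, existence and
  transience of the SLE_κ trace for `κ < 4` are theorems), with `W_0 = 0` a.e. from
  `drivingFunction_apply_zero` and the describability hypothesis read as `Loewner.IsDrivenBy`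
  (`isLoewnerDescribed_iff_isDrivenBy`, `isLoewnerDescribed_drivingFunction`).

No named fact is used; axioms `propext`, `Classical.choice`, `Quot.sound`.
-/

noncomputable section

open MeasureTheory Filter Topology Set
open scoped NNReal ENNReal Classical BigOperators
open Literature.Probability.LatticeModels
open Literature.Probability.RandomPlanarGeometry
open UpperHalfPlane (upperHalfPlaneSet)

namespace Summit.CriticalPhenomena.SAWScalingLimit.Theorems.SubseqIdentification.RoomEntropy

/-- **The room–entropy observable characterises SLE(8/3)** (registered stub
`stub_roomEntropyCharacterisesSLE` of the line `room-entropy-wright-fisher`, crux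
`SubseqIdentification`, stmt-CriticalPhenomena-0783): for a probability measure `ν` on curve
classes carried by Loewner-describable classes from `a = D.pt 0`, a filtration to which the
driving process `drivingFunction φ` is adapted, and the martingale property of every stopped
room–entropy observable `t ↦ roomObsStopped (drivingFunction φ c) w m t` (`w ∈ ℍ`, `m ∈ ℕ`),
the measure `ν` is the chordal SLE(8/3) law of `D`. Proof: the two far-field channels of the
observable (`Loewner.exists_level_roomObs_order_one` at `y(3+4i)/5`,
`Loewner.exists_level_roomObs_order_two` at `iy`) feed the exit-time localisation
`Process.isLocalMartingale_hasQuadraticVariation_of_approx`, and the tree's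
`isSLELaw_of_isLocalMartingale_driving_of_lt_four` (`0 < 8/3 < 4`) concludes. -/
theorem stub_roomEntropyCharacterisesSLE :
    ∀ (D : DobrushinDomain) (φ : ConformalEquiv upperHalfPlaneSet D.carrier)
      (ν : Measure (CurveClass ℂ)),
      D.IsChordalUniformizing φ → IsProbabilityMeasure ν →
      (∀ᵐ c ∂ν, IsLoewnerDescribable φ c ∧ c.source = D.pt 0) →
      ∀ 𝓕 : Filtration ℝ≥0 (inferInstance : MeasurableSpace (CurveClass ℂ)),
        Adapted 𝓕 (fun t c => drivingFunction φ c t) →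
        (∀ w : ℂ, 0 < w.im → ∀ m : ℕ,
          Martingale (fun t c => roomObsStopped (drivingFunction φ c) w m t) 𝓕 ν) →
      IsSLELaw ((8 : ℝ≥0) / 3) D ν := by
  intro D φ ν hφ hν hdesc 𝓕 hWad hN
  have hWc : ∀ c : CurveClass ℂ, Continuous fun t ↦ drivingFunction φ c t := fun c ↦
    continuous_drivingFunction φ c
  have hW0 : ∀ᵐ c ∂ν, drivingFunction φ c 0 = 0 := by
    filter_upwards [hdesc] with c hc
    exact drivingFunction_apply_zero hφ hc.2
  have h83 : (0 : ℝ≥0) < 8 / 3 := by norm_num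
  have h83' : ((8 / 3 : ℝ≥0) : ℝ) = 8 / 3 := by norm_num
  -- order one: the room–entropy observable seen from `y (3 + 4i)/5`, `y → ∞`
  have h1 : ∀ K : ℝ, 0 < K → ∀ T : ℝ≥0, ∀ ε : ℝ, 0 < ε →
      ∃ (Y : ℝ≥0 → CurveClass ℂ → ℝ) (a b : ℝ), a ≠ 0 ∧ Martingale Y 𝓕 ν ∧
        (∀ c, Continuous (Y · c)) ∧ ∀ᵐ c ∂ν, ∀ r : ℝ≥0, r ≤ T →
          (∀ u, u ≤ r → |drivingFunction φ c u| ≤ K) →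
            |Y r c - (a * drivingFunction φ c r + b)| ≤ ε * |a| := by
    intro K hK T ε hε
    obtain ⟨y, m, hy, hP⟩ := Loewner.exists_level_roomObs_order_one hK.le T hε
    have him : 0 < ((y : ℂ) * (3 + 4 * Complex.I) / 5).im := by
      rw [(Loewner.FarRegime.re_im_offAxis y).2]; positivity
    refine ⟨fun t c ↦ roomObsStopped (drivingFunction φ c) (y * (3 + 4 * Complex.I) / 5) m t,
      24 / 25 * Real.log 4 / y, 3 * Real.binEntropy (4 / 5), ?_, hN _ him m,
      fun c ↦ Loewner.continuous_roomObs_min (hWc c) him m,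
      ae_of_all _ fun c r hr hbd ↦ hP _ (hWc c) r hr hbd⟩
    have hlog4 : 0 < Real.log 4 := Real.log_pos (by norm_num)
    positivity
  -- order two: the room–entropy observable seen from `iy`, `y → ∞`
  have h2 : ∀ K : ℝ, 0 < K → ∀ T : ℝ≥0, ∀ ε : ℝ, 0 < ε →
      ∃ (Y : ℝ≥0 → CurveClass ℂ → ℝ) (a b : ℝ), a ≠ 0 ∧ Martingale Y 𝓕 ν ∧
        (∀ c, Continuous (Y · c)) ∧ ∀ᵐ c ∂ν, ∀ r : ℝ≥0, r ≤ T →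
          (∀ u, u ≤ r → |drivingFunction φ c u| ≤ K) →
            |Y r c - (a * (drivingFunction φ c r ^ 2 - ((8 / 3 : ℝ≥0) : ℝ) * r) + b)| ≤ ε * |a| := by
    intro K hK T ε hε
    obtain ⟨y, m, hy, hP⟩ := Loewner.exists_level_roomObs_order_two hK.le T hε
    have him : 0 < (Complex.I * (y : ℂ)).im := by simpa using hy
    refine ⟨fun t c ↦ roomObsStopped (drivingFunction φ c) (Complex.I * y) m t,
      -(3 / 2) / y ^ 2, 3 * Real.log 2, ?_, hN _ him m,
      fun c ↦ Loewner.continuous_roomObs_min (hWc c) him m,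
      ae_of_all _ fun c r hr hbd ↦ by rw [h83']; exact hP _ (hWc c) r hr hbd⟩
    have : (0 : ℝ) < 3 / 2 / y ^ 2 := by positivity
    rw [neg_div]; exact neg_ne_zero.2 this.ne'
  obtain ⟨hM, hQ⟩ :=
    Literature.Probability.Process.isLocalMartingale_hasQuadraticVariation_of_approx
      (W := fun t c ↦ drivingFunction φ c t) (P := ν) hWad hWc hW0 h83 h1 h2
  refine isSLELaw_of_isLocalMartingale_driving_of_lt_four h83 (by norm_num) hφ
    (measurable_drivingFunction_apply hφ) hW0 (ae_of_all _ fun c ↦ continuous_drivingFunction φ c)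
    hM hQ ?_
  filter_upwards [hdesc] with c hc
  exact (isLoewnerDescribed_iff_isDrivenBy.1 (isLoewnerDescribed_drivingFunction hc.1)).2

end Summit.CriticalPhenomena.SAWScalingLimit.Theorems.SubseqIdentification.RoomEntropy

end
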